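import Literature.AlgebraicGeometry.Resolution.LogRefinedChartUnits
import HarnessLib

/-!
# Crux `FrobeniusLadder.FRationalResolution` (stmt-ResolutionOfSingularities-15317), line `redirect`,
# stub `stub_diagonalizableQuotientResolution` — **a `ℤ`-basis of `ℤⁿ` adapted to `L ⊕ ℤv ⊕ ℤx`, and
# orthant-likeness of the monoids `L + {m v + l x : constraints}`** (point-blow-up recursion for the
# surface case, memo MEMO-15317-leafhand2-g6 §4: the transport from the coordinate descriptions of
# `…VertexChartMonoid` / `…VertexChartFaces` to the hypothesis `LogRefinedChart.IsOrthantLike` of the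
# Kato (10.3) engine `…ChartAlgebraOrthantPoints`)

For a subgroup `L ⊆ ℤⁿ` and `v, x ∈ ℤⁿ` with `L + ℤv + ℤx = ℤⁿ` and `(v, x)` independent modulo `L`:

* `exists_adapted_basis` — there is a `ℤ`-basis `b` of `ℤⁿ` and two indices `i₀ ≠ i₁` such that the
  `i₀`- and `i₁`-coordinates of `g + m·v + l·x` (`g ∈ L`) are `m` and `l`;
* **`exists_isOrthantLike_of_mem_iff`** — consequently a submonoid `Q ⊆ ℤⁿ` described by
  `Q = L + {m·v + l·x : (0 ≤ m if wanted) ∧ (0 ≤ l if wanted)}` is orthant-like (`ℕ^I ⊕ ℤ^{Iᶜ}` in the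
  basis `b`, `I ⊆ {i₀, i₁}`): the free end charts `L ⊕ ℕx ⊕ ℕ(v − x)`, the localisations
  `L ⊕ ℕv ⊕ ℤx` at the rays, and the torus `L ⊕ ℤv ⊕ ℤx` of the vertex chart monoid.

Honest label: linear-algebra glue toward ONE leaf stub (no stub, crux or summit closed). No definitions, no
named facts, no sorry. [cite: Kato1994, (9.8), (10.1)]
-/

-- single-problem summit: the doubled namespace component is forced
set_option linter.dupNamespace false

open Literature.AlgebraicGeometry.Resolution Literature.AlgebraicGeometry.Resolution.LogRefinedChart

namespace Summit.ResolutionOfSingularities.ResolutionOfSingularities.Theorems.FRationalResolution.AdaptedBasisOrthant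

variable {n : ℕ} {L : Submodule ℤ (Fin n → ℤ)} {v x : Fin n → ℤ}

/-- **A basis of `ℤⁿ` adapted to `ℤⁿ = L ⊕ ℤv ⊕ ℤx`.** If `(v, x)` is independent modulo `L` and
`L + ℤv + ℤx = ℤⁿ`, there are a `ℤ`-basis `b` of `ℤⁿ` and indices `i₀ ≠ i₁` with
`b*_{i₀}(g + m v + l x) = m`, `b*_{i₁}(g + m v + l x) = l` for all `g ∈ L`. [folklore] -/
theorem exists_adapted_basis
    (hind : ∀ g ∈ L, ∀ m l : ℤ, g + m • v + l • x = 0 → m = 0 ∧ l = 0)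
    (hspan : ∀ w : Fin n → ℤ, ∃ g ∈ L, ∃ m l : ℤ, w = g + m • v + l • x) :
    ∃ (b : Module.Basis (Fin n) ℤ (Fin n → ℤ)) (i₀ i₁ : Fin n), i₀ ≠ i₁ ∧
      ∀ g ∈ L, ∀ m l : ℤ, b.repr (g + m • v + l • x) i₀ = m ∧ b.repr (g + m • v + l • x) i₁ = l := by
  classical
  -- a basis of `L`
  let bL := Module.Free.chooseBasis ℤ L
  let ι := Module.Free.ChooseBasisIndex ℤ L
  let eL : ι → (Fin n → ℤ) := fun i => (bL i : Fin n → ℤ)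
  have hliL : LinearIndependent ℤ eL :=
    bL.linearIndependent.map' L.subtype (Submodule.ker_subtype L)
  have hspanL : Submodule.span ℤ (Set.range eL) = L := by
    have : Set.range eL = L.subtype '' Set.range bL := by
      rw [← Set.range_comp]; rfl
    rw [this, Submodule.span_image, bL.span_eq, Submodule.map_top, Submodule.range_subtype]
  -- the pair `(v, x)`
  let e2 : Fin 2 → (Fin n → ℤ) := ![v, x]
  have hli2 : LinearIndependent ℤ e2 := by
    rw [LinearIndependent.pair_iff]
    intro s t hst
    exact hind 0 L.zero_mem s t (by rw [zero_add]; exact hst)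
  have hrange2 : Set.range e2 = {v, x} := by
    change Set.range ![v, x] = {v, x}
    rw [Matrix.range_cons, Matrix.range_cons, Matrix.range_empty, Set.union_empty, Set.insert_eq]
  have hdisj : Disjoint (Submodule.span ℤ (Set.range eL)) (Submodule.span ℤ (Set.range e2)) := by
    rw [hspanL, hrange2, Submodule.disjoint_def]
    intro z hzL hz2
    obtain ⟨s, t, rfl⟩ := Submodule.mem_span_pair.1 hz2
    have h1 : (-(s • v + t • x)) + s • v + t • x = 0 := by abel
    obtain ⟨hs, ht⟩ := hind _ (L.neg_mem hzL) s t h1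
    rw [hs, ht, zero_smul, zero_smul, add_zero]
  have hli : LinearIndependent ℤ (Sum.elim eL e2) := hliL.sum_type hli2 hdisj
  have hsp : ⊤ ≤ Submodule.span ℤ (Set.range (Sum.elim eL e2)) := by
    rintro w -
    obtain ⟨g, hg, m, l, rfl⟩ := hspan w
    rw [Set.Sum.elim_range]
    refine Submodule.add_mem _ (Submodule.add_mem _ ?_ ?_) ?_
    · exact Submodule.span_mono Set.subset_union_left (hspanL.symm ▸ hg)
    · exact Submodule.smul_mem _ _ (Submodule.subset_span (Or.inr ⟨0, rfl⟩))
    · exact Submodule.smul_mem _ _ (Submodule.subset_span (Or.inr ⟨1, rfl⟩))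
  let b₀ : Module.Basis (ι ⊕ Fin 2) ℤ (Fin n → ℤ) := Module.Basis.mk hli hsp
  -- reindex by `Fin n`
  have hcard : Fintype.card (ι ⊕ Fin 2) = Fintype.card (Fin n) := by
    rw [← Module.finrank_eq_card_basis b₀, Module.finrank_fin_fun, Fintype.card_fin]
  let eqv : (ι ⊕ Fin 2) ≃ Fin n := Fintype.equivOfCardEq hcard
  let b : Module.Basis (Fin n) ℤ (Fin n → ℤ) := b₀.reindex eqv
  -- coordinates
  have hrepr_g : ∀ g ∈ L, ∀ k : Fin 2, b₀.repr g (Sum.inr k) = 0 := by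
    intro g hg k
    have hg' : g ∈ Submodule.span ℤ (Set.range eL) := by rw [hspanL]; exact hg
    have hsub : Set.range eL ⊆ b₀ '' Set.range (Sum.inl : ι → ι ⊕ Fin 2) := by
      rintro _ ⟨i, rfl⟩
      exact ⟨Sum.inl i, ⟨i, rfl⟩, by simp [b₀]⟩
    have hg'' : g ∈ Submodule.span ℤ (b₀ '' Set.range (Sum.inl : ι → ι ⊕ Fin 2)) :=
      Submodule.span_mono hsub hg'
    have := b₀.repr_support_subset_of_mem_span (Set.range (Sum.inl : ι → ι ⊕ Fin 2)) hg''
    by_contra hne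
    have hmem : Sum.inr k ∈ ((b₀.repr g).support : Set (ι ⊕ Fin 2)) := Finsupp.mem_support_iff.2 hne
    obtain ⟨i, hi⟩ := this hmem
    exact Sum.inl_ne_inr hi
  have hrepr_v : b₀.repr v = Finsupp.single (Sum.inr 0) 1 := by
    have : v = b₀ (Sum.inr 0) := by simp [b₀, Module.Basis.mk_apply, e2]
    rw [this, b₀.repr_self]
  have hrepr_x : b₀.repr x = Finsupp.single (Sum.inr 1) 1 := by
    have : x = b₀ (Sum.inr 1) := by simp [b₀, Module.Basis.mk_apply, e2]
    rw [this, b₀.repr_self]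
  refine ⟨b, eqv (Sum.inr 0), eqv (Sum.inr 1), ?_, ?_⟩
  · intro h
    have := eqv.injective h
    simp at this
  · intro g hg m l
    simp only [b, Module.Basis.repr_reindex_apply, Equiv.symm_apply_apply, map_add, map_zsmul,
      Finsupp.add_apply, Finsupp.smul_apply, hrepr_g g hg, hrepr_v, hrepr_x, Finsupp.single_apply]
    simp

/-- **Monoids `L + {m v + l x : sign constraints}` are orthant-like.** With `L`, `v`, `x` as in
`exists_adapted_basis` and `T ⊆ {0, 1}` the set of constrained coordinates, a submonoid `Q` with
`w ∈ Q ↔ w = g + m v + l x, g ∈ L, (0 ∈ T → 0 ≤ m), (1 ∈ T → 0 ≤ l)` is `ℕ^I ⊕ ℤ^{Iᶜ}` in a `ℤ`-basis of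
`ℤⁿ` (`LogRefinedChart.IsOrthantLike`). [cite: Kato1994, (9.8), (10.1)] -/
theorem exists_isOrthantLike_of_mem_iff {Q : AddSubmonoid (Fin n → ℤ)}
    (hind : ∀ g ∈ L, ∀ m l : ℤ, g + m • v + l • x = 0 → m = 0 ∧ l = 0)
    (hspan : ∀ w : Fin n → ℤ, ∃ g ∈ L, ∃ m l : ℤ, w = g + m • v + l • x) (T : Finset (Fin 2))
    (hQ : ∀ w, w ∈ Q ↔ ∃ g ∈ L, ∃ m l : ℤ, (0 ∈ T → 0 ≤ m) ∧ (1 ∈ T → 0 ≤ l) ∧ w = g + m • v + l • x) :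
    ∃ (b : Module.Basis (Fin n) ℤ (Fin n → ℤ)) (I : Finset (Fin n)), IsOrthantLike b I Q := by
  classical
  obtain ⟨b, i₀, i₁, hne, hcoord⟩ := exists_adapted_basis hind hspan
  let idx : Fin 2 → Fin n := ![i₀, i₁]
  refine ⟨b, T.image idx, ⟨fun w => ?_⟩⟩
  obtain ⟨g, hg, m, l, rfl⟩ := hspan w
  obtain ⟨h0, h1⟩ := hcoord g hg m l
  constructor
  · intro hw i hi
    obtain ⟨g', hg', m', l', hm', hl', hEq⟩ := (hQ _).1 hw
    obtain ⟨h0', h1'⟩ := hcoord g' hg' m' l'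
    rw [hEq]
    obtain ⟨k, hk, rfl⟩ := Finset.mem_image.1 hi
    fin_cases k
    · change 0 ≤ b.repr (g' + m' • v + l' • x) i₀
      rw [h0']; exact hm' hk
    · change 0 ≤ b.repr (g' + m' • v + l' • x) i₁
      rw [h1']; exact hl' hk
  · intro hw
    refine (hQ _).2 ⟨g, hg, m, l, fun hk => ?_, fun hk => ?_, rfl⟩
    · have := hw (idx 0) (Finset.mem_image_of_mem _ hk)
      change 0 ≤ b.repr (g + m • v + l • x) i₀ at this
      rwa [h0] at this
    · have := hw (idx 1) (Finset.mem_image_of_mem _ hk)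
      change 0 ≤ b.repr (g + m • v + l • x) i₁ at this
      rwa [h1] at this

end Summit.ResolutionOfSingularities.ResolutionOfSingularities.Theorems.FRationalResolution.AdaptedBasisOrthant
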